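import Summits.HodgeConjecture.HodgeConjecture.Theorems.F0P3cStCharTSSaHeadTorus      -- ★ p849458 the concrete head with ONE (TOR) hypothesis (∃-form)
import Summits.HodgeConjecture.HodgeConjecture.Theorems.F0P3cStCharTSPsmTransport     -- ★ p849653 «PSM★» (`psm_torusTransform`), ★ p849564 TorusDefs, ★ p849607 CHART-ISO
import Summits.HodgeConjecture.HodgeConjecture.Theorems.F0P3cStCharTSVanDijkWeylSymm   -- ★ p849696 «VDW-SYMM★» (LH6-p02 g2): `vanDijkWeight_weylConj`
import HarnessLib

/-!
# F0 · P3c · line LH6 «StCharTS» — «Sa-HEAD★» EDITION «(PSM) OUT, NAMED TERMS IN»: organ (S-a) with the split-torus package AT THE NAMED TERMS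
# (`torusTransform`, `hyperbolicSet`, `pairChar`), (PSM) discharged by ★ «PSM★»  [Rogawski1990, L. 12.7.2 (proof) pp. 191–194; §4.9 (4.9.4) p. 56]

Cell `pub/hodgecm-mathlib`, crux H413 = `stmt-HodgeConjecture-24833` (`--supports` lane, helper), route HCCMUnconditional; seat LH6-p01 (g2), integrator of the (TOR) road.
THEOREMS ONLY, sorry-free.  THE STATEMENT `stSupportFiniteSqInt_of_carpet_torus₂` = ★ p849458 `stSupportFiniteSqInt_of_carpet_torus` with its ONE hypothesis (TOR)
«∀ μM Haar, ∃ Ftr Ω toC, pin ∧ (WM∕L2M) ∧ (HM) ∧ (PSM) ∧ (SHF′)» REPLACED by (TOR′) «∀ μM Haar, (WM∕L2M) ∧ (HM) ∧ (SHF′) with `Ftr := torusTransform L v mQv μM`,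
`Ω := hyperbolicSet L v`, `toC := pairChar L v` substituted» (texts otherwise VERBATIM) — the pin is `rfl` (★ `pairChar_apply`) and (PSM) is ★ `psm_torusTransform` —
the W-invariance of van Dijk's weight that ★ «PSM★» consumes is ★ «VDW-SYMM★» `vanDijkWeight_weylConj` (LH6-p02 (g2), p849696) — NO extra hypothesis.
HONEST LABEL: HC_CM is proved only modulo the 7 printed citations (2 remaining: hLiu418 = stmt-HodgeConjecture-24832, h413 = stmt-HodgeConjecture-24833) until rung 0
closes; count-neutral, hypothesis-fed ((WM∕L2M)(HM)(SHF′) are print-true NAMED inputs about CONCRETE objects now).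

## References
* [Rogawski1990] J. D. Rogawski, *Automorphic Representations of Unitary Groups in Three Variables*, Ann. of Math. Stud. 123 (1990): §12.7 L. 12.7.1 (proof) p. 191,
  L. 12.7.2 (proof) pp. 191–194; §12.2 p. 173; §4.9 (4.9.4) p. 56.
-/

set_option autoImplicit false
-- the mandated namespace has the single-problem summit's repeated segment (`HodgeConjecture.HodgeConjecture`)
set_option linter.dupNamespace false

noncomputable section

open NumberField IsDedekindDomain MeasureTheory MeasureTheory.Measure Filter Topology
open scoped Matrix MatrixGroups BigOperators Pointwise
open Literature.NumberTheory.Rogawski1990 Literature.NumberTheory.Automorphic Literature.NumberTheory.Automorphic.UnitaryGroup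
open Literature.NumberTheory.GaloisRepresentations
open Literature.MeasureTheory.Group

namespace Summit.HodgeConjecture.HodgeConjecture.Cruxes.H413.F0P3cStCharTSSaHeadTorus2

open Literature.NumberTheory.Rogawski1990.Ch12Sec5
open Summit.HodgeConjecture.HodgeConjecture.Cruxes.H413.F0P3cStCharTSTorusDefs
open Summit.HodgeConjecture.HodgeConjecture.Cruxes.H413.F0P3cStCharTSPsmTransport

set_option maxHeartbeats 1600000 in
-- the statement alone (≈ 230 lines of binders) exceeds the default budget; the proof is ★ p849458 + ★ «PSM★»
/-- **«Sa-HEAD★» EDITION «(PSM) OUT, NAMED TERMS IN»** — organ (S-a) from the §12.5–12.6 datum (COMPAT 7), the TR carpets, the datum-level sockets, (SPLIT-NOT-ELL), the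
split-torus package (TOR′) AT THE NAMED TERMS; the weight symmetry is ★ p849696. [cite: Rogawski1990, §12.7 Lemma 12.7.2 (proof) pp. 191–194; §4.9 (4.9.4) p. 56] -/
theorem stSupportFiniteSqInt_of_carpet_torus₂ :
  ∀ (L : Type) [Field L] [NumberField L] [IsCMField L] (μ : HeckeCharacter L) (ξ : OneDimAutRepH L) (v : HeightOneSpectrum (𝓞 ↥(maximalRealSubfield L))),
    (∀ w : PlacesOver L v, IsCMField.complexConj L • w.1 = w.1) → μ.IsUnitary →
    (∀ x : Literature.NumberTheory.GaloisRepresentations.ideleGroup ↥(maximalRealSubfield L),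
      μ (AdeleRing.ideleBaseChange (↥(maximalRealSubfield L)) L x) = quadraticHeckeCharCM L x) →
    ∀ [MeasurableSpace ((UnitaryGroup.cmDatum L 2 (Matrix.of fun i j : Fin 2 => if i.val + j.val + 1 = 2 then (1 : L) else 0)).Local v × (UnitaryGroup.cmDatum L 1 (Matrix.of fun i j : Fin 1 => if i.val + j.val + 1 = 1 then (1 : L) else 0)).Local v)] [BorelSpace ((UnitaryGroup.cmDatum L 2 (Matrix.of fun i j : Fin 2 => if i.val + j.val + 1 = 2 then (1 : L) else 0)).Local v × (UnitaryGroup.cmDatum L 1 (Matrix.of fun i j : Fin 1 => if i.val + j.val + 1 = 1 then (1 : L) else 0)).Local v)] [MeasurableSpace (Gqs L v)] [BorelSpace (Gqs L v)]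
      (νHv : Measure ((UnitaryGroup.cmDatum L 2 (Matrix.of fun i j : Fin 2 => if i.val + j.val + 1 = 2 then (1 : L) else 0)).Local v × (UnitaryGroup.cmDatum L 1 (Matrix.of fun i j : Fin 1 => if i.val + j.val + 1 = 1 then (1 : L) else 0)).Local v)) (νQv : Measure (Gqs L v))
      [νHv.IsHaarMeasure] [νHv.IsMulRightInvariant] [νQv.IsHaarMeasure] [νQv.IsMulRightInvariant],
    letI : ∀ a : ((UnitaryGroup.cmDatum L 2 (Matrix.of fun i j : Fin 2 => if i.val + j.val + 1 = 2 then (1 : L) else 0)).Local v × (UnitaryGroup.cmDatum L 1 (Matrix.of fun i j : Fin 1 => if i.val + j.val + 1 = 1 then (1 : L) else 0)).Local v), MeasurableSpace (((UnitaryGroup.cmDatum L 2 (Matrix.of fun i j : Fin 2 => if i.val + j.val + 1 = 2 then (1 : L) else 0)).Local v × (UnitaryGroup.cmDatum L 1 (Matrix.of fun i j : Fin 1 => if i.val + j.val + 1 = 1 then (1 : L) else 0)).Local v) ⧸ Subgroup.centralizer ({a} : Set ((UnitaryGroup.cmDatum L 2 (Matrix.of fun i j : Fin 2 => if i.val + j.val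 + 1 = 2 then (1 : L) else 0)).Local v × (UnitaryGroup.cmDatum L 1 (Matrix.of fun i j : Fin 1 => if i.val + j.val + 1 = 1 then (1 : L) else 0)).Local v))) := fun _ => borel _
    haveI : ∀ a : ((UnitaryGroup.cmDatum L 2 (Matrix.of fun i j : Fin 2 => if i.val + j.val + 1 = 2 then (1 : L) else 0)).Local v × (UnitaryGroup.cmDatum L 1 (Matrix.of fun i j : Fin 1 => if i.val + j.val + 1 = 1 then (1 : L) else 0)).Local v), BorelSpace (((UnitaryGroup.cmDatum L 2 (Matrix.of fun i j : Fin 2 => if i.val + j.val + 1 = 2 then (1 : L) else 0)).Local v × (UnitaryGroup.cmDatum L 1 (Matrix.of fun i j : Fin 1 => if i.val + j.val + 1 = 1 then (1 : L) else 0)).Local v) ⧸ Subgroup.centralizer ({a} : Set ((UnitaryGroup.cmDatum L 2 (Matrix.of fun i j : Fin 2 => if i.val + j.val + 1 = 2 then (1 : L) else 0)).Local v × (UnitaryGroup.cmDatum L 1 (Matrix.of fun i j : Fin 1 => if i.val + j.val + 1 = 1 then (1 : L) else 0)).Local v))) := fun _ => ⟨rfl⟩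
    letI : ∀ γ : Gqs L v, MeasurableSpace (Gqs L v ⧸ Subgroup.centralizer ({γ} : Set (Gqs L v))) := fun _ => borel _
    haveI : ∀ γ : Gqs L v, BorelSpace (Gqs L v ⧸ Subgroup.centralizer ({γ} : Set (Gqs L v))) := fun _ => ⟨rfl⟩
    ∀ (mHv : OrbitalMeasureFamily ((UnitaryGroup.cmDatum L 2 (Matrix.of fun i j : Fin 2 => if i.val + j.val + 1 = 2 then (1 : L) else 0)).Local v × (UnitaryGroup.cmDatum L 1 (Matrix.of fun i j : Fin 1 => if i.val + j.val + 1 = 1 then (1 : L) else 0)).Local v)) (mQv : OrbitalMeasureFamily (Gqs L v)),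
      mHv.IsCanonical (IsLocalGRegular L v) νHv →
      mQv.IsCanonical (fun γ => IsRegularElt (γ.val : GL (Fin 3) (UnitaryGroup.LocalRing L v))) νQv →
      IsLocalDeltaTransferExists L (qsForm L) v ((finExplicitCollection L (qsForm L) μ (finExplicitDelta_conj_left_all L (qsForm L) μ) (finExplicitDelta_conj_right_all L (qsForm L) μ)) v) mHv mQv IsLocSmooth IsLocSmooth →
      ∀ (π₁ πSt : IrrClass ((UnitaryGroup.cmDatum L 2 (Matrix.of fun i j : Fin 2 => if i.val + j.val + 1 = 2 then (1 : L) else 0)).Local v × (UnitaryGroup.cmDatum L 1 (Matrix.of fun i j : Fin 1 => if i.val + j.val + 1 = 1 then (1 : L) else 0)).Local v)),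
        HLengthTwoLabels L v
          (torusCharPair (conjLocal L (IsCMField.complexConj L) v) (cmLocalForm L 2 v) (cmLocalForm_eq_over L 2 v) 0
            ((torusLocalComponent L (IsCMField.complexConj L) v ξ.η).comp
                (quotConj (conjLocal L (IsCMField.complexConj L) v) (conjLocal_conjLocal_cm L v)) *
              halfModulusChar (UnitaryGroup.LocalRing L v))
            (torusLocalComponent L (IsCMField.complexConj L) v ξ.ψ))
          ((torusLocalComponent L (IsCMField.complexConj L) v ξ.ψ).comp (localDet (IsCMField.complexConj L) v (isUnit_antidiagOne_det L 1))) π₁ πSt →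
        (∀ fH : ((UnitaryGroup.cmDatum L 2 (Matrix.of fun i j : Fin 2 => if i.val + j.val + 1 = 2 then (1 : L) else 0)).Local v × (UnitaryGroup.cmDatum L 1 (Matrix.of fun i j : Fin 1 => if i.val + j.val + 1 = 1 then (1 : L) else 0)).Local v) → ℂ, IsLocSmooth fH → π₁.smoothTrace νHv fH = charDist (ξ.xiLocalChar v) νHv fH) →
      ∀ [MeasurableSpace (Gqs L v ⧸ Subgroup.center (Gqs L v))] [BorelSpace (Gqs L v ⧸ Subgroup.center (Gqs L v))]
        (μZ : Measure (Gqs L v ⧸ Subgroup.center (Gqs L v))) [μZ.IsHaarMeasure],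
      -- ══ the §12.5–12.6 DATUM on the model (★ TR carpet, a BINDER) and its COMPATIBILITY with the organ's currency (byte-identical with ★ p848567 ∕ ★ p848673) ══
      ∀ (𝔇 : Ch12Sec5.EllipticData (Gqs L v) ((UnitaryGroup.cmDatum L 2 (Matrix.of fun i j : Fin 2 => if i.val + j.val + 1 = 2 then (1 : L) else 0)).Local v × (UnitaryGroup.cmDatum L 1 (Matrix.of fun i j : Fin 1 => if i.val + j.val + 1 = 1 then (1 : L) else 0)).Local v)),
      𝔇.μG = νQv → 𝔇.μH = νHv → 𝔇.μGZ = μZ → 𝔇.orb = mQv →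
      (∀ γ : Gqs L v, γ ∈ 𝔇.regG ↔ IsRegularElt (γ.val : GL (Fin 3) (UnitaryGroup.LocalRing L v))) →
      (∀ (φ : Gqs L v → ℂ) (fH : ((UnitaryGroup.cmDatum L 2 (Matrix.of fun i j : Fin 2 => if i.val + j.val + 1 = 2 then (1 : L) else 0)).Local v × (UnitaryGroup.cmDatum L 1 (Matrix.of fun i j : Fin 1 => if i.val + j.val + 1 = 1 then (1 : L) else 0)).Local v) → ℂ), 𝔇.IsTransfer φ fH ↔ IsLocalDeltaTransfer L (qsForm L) v ((finExplicitCollection L (qsForm L) μ (finExplicitDelta_conj_left_all L (qsForm L) μ) (finExplicitDelta_conj_right_all L (qsForm L) μ)) v) mHv mQv fH φ) →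
      ({πSt} : Finset (IrrClass ((UnitaryGroup.cmDatum L 2 (Matrix.of fun i j : Fin 2 => if i.val + j.val + 1 = 2 then (1 : L) else 0)).Local v × (UnitaryGroup.cmDatum L 1 (Matrix.of fun i j : Fin 1 => if i.val + j.val + 1 = 1 then (1 : L) else 0)).Local v))) ∈ 𝔇.sqPacketsH →
      -- ══ CARPET RELATIONS (named facts of ★ `Ch12Sec5` ∕ ★ `Ch12Sec6`, read at `𝔇`; union of ★ «Sa-COMPOSE» p848625 and ★ (R) p848976) ══
      𝔇.WeylIntegrationFormula → 𝔇.UpSpec → Ch12Sec6.PseudoCoeffExists 𝔇 → Ch12Sec6.PseudoCoeffTrace 𝔇 →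
      Ch12Sec6.Prop1261a 𝔇 → Ch12Sec6.Prop1261b 𝔇 → Ch12Sec6.Prop1261c 𝔇 →
      Ch12Sec6.LdsCharactersOpposite 𝔇 → Ch12Sec6.EllipticOfNotPrincipalSeries 𝔇 → Ch12Sec6.EllipticClassification 𝔇 →
      -- ══ PRINTED INPUTS NO CARPET STATES YET, in the socket shapes of LH6-p01's `Ch12Sec5Inputs` draft: (M1H) `PacketCharRegular`, (UPR) `UpRegular`, (ELL) `EllipticOfL2`,
      --    (DET) `DetNotL2`, (PIN) `PiNNotL2`, (LDS) `LdsNotL2`; and FIVE new sockets for the §12.7 (b)-row: (L2D∀) `D_G·χ_π ∈ L²(T)` for EVERY class, (U2) `D_G·χ_ρ^G ∈ L²(T)`,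
      --    (C1) `cartanG ⊆ cartanAll`, (C2) elliptic representatives a.e. in `G^e`, (C3) the other representatives a.e. in `G^r ∖ G^e` ══
      (∀ ρ ∈ 𝔇.sqPacketsH, Measurable (𝔇.packetCharH ρ) ∧ LocallyIntegrable (𝔇.packetCharH ρ) 𝔇.μH ∧
          Ch12Sec5.IsStableClassFunOn 𝔇.stConjH 𝔇.regH (𝔇.packetCharH ρ) ∧ Ch12Sec5.IsStableClassFunOn 𝔇.stConjH 𝔇.ellH (𝔇.packetCharH ρ) ∧
          ∀ fH : ((UnitaryGroup.cmDatum L 2 (Matrix.of fun i j : Fin 2 => if i.val + j.val + 1 = 2 then (1 : L) else 0)).Local v × (UnitaryGroup.cmDatum L 1 (Matrix.of fun i j : Fin 1 => if i.val + j.val + 1 = 1 then (1 : L) else 0)).Local v) → ℂ, IsLocSmooth fH → (∑ σ ∈ ρ, σ.smoothTrace 𝔇.μH fH) = ∫ h, fH h * 𝔇.packetCharH ρ h ∂𝔇.μH) →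
      (∀ ρ ∈ 𝔇.sqPacketsH, LocallyIntegrable (𝔇.up (𝔇.packetCharH ρ)) 𝔇.μG ∧
          ∀ x ∈ 𝔇.regG, ∀ᶠ y in 𝓝 x, 𝔇.up (𝔇.packetCharH ρ) y = 𝔇.up (𝔇.packetCharH ρ) x) →
      (∀ π : IrrClass (Gqs L v), 𝔇.IsL2 π → 𝔇.IsEllipticRep π) →
      (∀ ψ : ↥(Subgroup.center (Gqs L v)) →* ℂˣ, Continuous ψ → ¬ 𝔇.IsL2 (𝔇.detG ψ)) →
      (∀ ξ' : ((UnitaryGroup.cmDatum L 2 (Matrix.of fun i j : Fin 2 => if i.val + j.val + 1 = 2 then (1 : L) else 0)).Local v × (UnitaryGroup.cmDatum L 1 (Matrix.of fun i j : Fin 1 => if i.val + j.val + 1 = 1 then (1 : L) else 0)).Local v) →* ℂˣ, Continuous ξ' → ¬ 𝔇.IsL2 (𝔇.piN ξ')) →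
      (∀ P ∈ 𝔇.ldsPackets, ∀ σ ∈ P, ¬ 𝔇.IsL2 σ) →
      (∀ π : IrrClass (Gqs L v), ∀ T ∈ 𝔇.cartanG, MemLp (fun t : ↥T => (𝔇.DG (t : Gqs L v) : ℂ) * 𝔇.char π (t : Gqs L v)) 2 (𝔇.μT T)) →
      (∀ ρ ∈ 𝔇.sqPacketsH, ∀ T ∈ 𝔇.cartanG, MemLp (fun t : ↥T => (𝔇.DG (t : Gqs L v) : ℂ) * 𝔇.up (𝔇.packetCharH ρ) (t : Gqs L v)) 2 (𝔇.μT T)) →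
      𝔇.cartanG ⊆ 𝔇.cartanAll →
      (∀ T ∈ 𝔇.cartanG, ∀ᵐ t : ↥T ∂(𝔇.μT T), (t : Gqs L v) ∈ 𝔇.ellG) →
      (∀ T ∈ 𝔇.cartanAll, T ∉ 𝔇.cartanG → ∀ᵐ t : ↥T ∂(𝔇.μT T), (t : Gqs L v) ∈ 𝔇.regG ∧ (t : Gqs L v) ∉ 𝔇.ellG) →
      -- ══ further datum-level sockets of ★ (R) p848976: (LDSE) (LDSU) (LDS2) (R0) (MATE-UNIQ) (ST-L2) (PI2-L2) — (SC-L2) «supercuspidal ⇒ square-integrable» is DISCHARGED below (compact centre at the non-split `v`) ══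
      (∀ P ∈ 𝔇.ldsPackets, ∀ σ ∈ P, 𝔇.IsEllipticRep σ) →
      (∀ P ∈ 𝔇.ldsPackets, ∀ π' ∈ P, ∀ π : IrrClass (Gqs L v), π ∉ P → ¬ 𝔇.IsEllipticPair π π') →
      (∀ P ∈ 𝔇.ldsPackets, ∀ σ ∈ P, ∃ σ' ∈ P, σ' ≠ σ ∧ ∀ τ ∈ P, τ = σ ∨ τ = σ') →
      (∀ P ∈ 𝔇.ldsPackets, ∀ π' ∈ P, ∀ f : Gqs L v → ℂ, 𝔇.IsPseudoCoeff π' f → ∀ fH : ((UnitaryGroup.cmDatum L 2 (Matrix.of fun i j : Fin 2 => if i.val + j.val + 1 = 2 then (1 : L) else 0)).Local v × (UnitaryGroup.cmDatum L 1 (Matrix.of fun i j : Fin 1 => if i.val + j.val + 1 = 1 then (1 : L) else 0)).Local v) → ℂ, IsLocSmooth fH → 𝔇.IsTransfer f fH →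
          (∑ σ ∈ ({πSt} : Finset (IrrClass ((UnitaryGroup.cmDatum L 2 (Matrix.of fun i j : Fin 2 => if i.val + j.val + 1 = 2 then (1 : L) else 0)).Local v × (UnitaryGroup.cmDatum L 1 (Matrix.of fun i j : Fin 1 => if i.val + j.val + 1 = 1 then (1 : L) else 0)).Local v))), σ.smoothTrace 𝔇.μH fH) = 0) →
      (∀ σ u u' : IrrClass (Gqs L v), 𝔇.IsL2 σ → ¬ 𝔇.IsL2 u → ¬ 𝔇.IsL2 u' → 𝔇.IsEllipticPair u σ → 𝔇.IsEllipticPair u' σ → u = u') →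
      (∀ ψ' : ↥(Subgroup.center (Gqs L v)) →* ℂˣ, Continuous ψ' → 𝔇.IsL2 (𝔇.stG ψ')) →
      (∀ ξ' : ((UnitaryGroup.cmDatum L 2 (Matrix.of fun i j : Fin 2 => if i.val + j.val + 1 = 2 then (1 : L) else 0)).Local v × (UnitaryGroup.cmDatum L 1 (Matrix.of fun i j : Fin 1 => if i.val + j.val + 1 = 1 then (1 : L) else 0)).Local v) →* ℂˣ, Continuous ξ' → 𝔇.IsL2 (𝔇.pi2 ξ')) →
      -- ══ THE PRINCIPAL SERIES OF THE NON-SQUARE-INTEGRABLE CLASSES [§12.2]: a parameter map `par` into the tree's PAIR currency, with (PS1) (PS2) (PS3)=(JHL) (NONL2-PAR) (UNIQ-PAR) ══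
      ∀ (par : IrrClass (Gqs L v) → (((UnitaryGroup.LocalRing L v)ˣ →* ℂˣ) × (↥(normOneUnits (conjLocal L (IsCMField.complexConj L) v)) →* ℂˣ))),
      (∀ π ∈ 𝔇.irredPS, ¬ 𝔇.IsL2 π → ∀ f : Gqs L v → ℂ, IsLocSmooth f → π.smoothTrace νQv f = Representation.smoothTrace (G := Gqs L v) (UnitaryGroup.cmPrincipalSeries L 3 v (UnitaryGroup.cmTorusCharPair L v (par π).1 (par π).2)) νQv f) →
      (∀ π σ : IrrClass (Gqs L v), ¬ 𝔇.IsL2 π → 𝔇.IsL2 σ → 𝔇.IsEllipticPair π σ → ∀ f : Gqs L v → ℂ, IsLocSmooth f →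
          π.smoothTrace νQv f + σ.smoothTrace νQv f = Representation.smoothTrace (G := Gqs L v) (UnitaryGroup.cmPrincipalSeries L 3 v (UnitaryGroup.cmTorusCharPair L v (par π).1 (par π).2)) νQv f) →
      (∀ P ∈ 𝔇.ldsPackets, ∀ π' ∈ P, ∀ π'' ∈ P, π' ≠ π'' → par π'' = par π' ∧ ∀ f : Gqs L v → ℂ, IsLocSmooth f →
          π'.smoothTrace νQv f + π''.smoothTrace νQv f = Representation.smoothTrace (G := Gqs L v) (UnitaryGroup.cmPrincipalSeries L 3 v (UnitaryGroup.cmTorusCharPair L v (par π').1 (par π').2)) νQv f) →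
      (∀ π : IrrClass (Gqs L v), ¬ 𝔇.IsL2 π →
          π.IsConstituentOf (UnitaryGroup.cmPrincipalSeries L 3 v (UnitaryGroup.cmTorusCharPair L v (par π).1 (par π).2)) ∧
            Continuous (par π).1 ∧ Continuous (par π).2) →
      (∀ u u' : IrrClass (Gqs L v), ¬ 𝔇.IsL2 u → ¬ 𝔇.IsL2 u' →
          (par u' = par u ∨ par u' = (conjInvChar (conjLocal L (IsCMField.complexConj L) v) (par u).1, (par u).2)) →
          u' = u ∨ ∃ P ∈ 𝔇.ldsPackets, u ∈ P ∧ u' ∈ P) →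
      -- ══ LH6-p05's split-torus block in place of §1's binder `hF` (★ F3′ p849140's sockets, ∀-forms) ══
      -- ══ (SPLIT-NOT-ELL) «a REGULAR element of the split torus `T ⊂ U(Φ₃)(L⁺_v)` is not in `G^e`» [§12.5 p. 184] — the structural socket that ★ «PSE★» `F0P3cStCharTSPsePseudo` trades (PSE) for ══
      (∀ t : ↥(cmBorelTriple L 3 v).M, IsRegularElt ((((t : ↥(unitaryGroupOfForm (conjLocal L (IsCMField.complexConj L) v) (cmLocalForm L 3 v))) : Gqs L v).val : GL (Fin 3) (UnitaryGroup.LocalRing L v))) → ((t : ↥(unitaryGroupOfForm (conjLocal L (IsCMField.complexConj L) v) (cmLocalForm L 3 v))) : Gqs L v) ∉ 𝔇.ellG) →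
      -- ══ (TOR′) THE SPLIT-TORUS PACKAGE AT THE NAMED TERMS (★ p849564 `F0P3cStCharTSTorusDefs`): under the BOREL σ-algebra of `M = E_vˣ × E¹_v`, for EVERY Haar measure `μM`,
      --    van Dijk's torus transform `torusTransform L v mQv μM` (print's `F_f`, [L. 12.7.2 proof p. 193]), the regular hyperbolic set `hyperbolicSet L v` and the product characters
      --    `pairChar L v` satisfy (WM∕L2M) ∧ (HM) ∧ (SHF′) — the pin of (TOR) is `rfl` (★ `pairChar_apply`) and its (PSM) is ★ `F0P3cStCharTSPsmTransport.psm_torusTransform` (no longer conjuncts) ══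
      (letI : MeasurableSpace ((UnitaryGroup.LocalRing L v)ˣ × ↥(normOneUnits (conjLocal L (IsCMField.complexConj L) v))) := borel _
      haveI : BorelSpace ((UnitaryGroup.LocalRing L v)ˣ × ↥(normOneUnits (conjLocal L (IsCMField.complexConj L) v))) := ⟨rfl⟩
      ∀ (μM : Measure ((UnitaryGroup.LocalRing L v)ˣ × ↥(normOneUnits (conjLocal L (IsCMField.complexConj L) v)))) [μM.IsHaarMeasure],
        -- (WM∕L2M) Weyl integration on hyperbolic support for EVERY square-integrable class σ, `Θ_σ = D_G χ_σ|_M ∈ L¹(M)` [§12.5 p. 182; p. 193]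
        (∀ σ : IrrClass (Gqs L v), σ.IsSquareIntegrable μZ → ∃ Θ : ((UnitaryGroup.LocalRing L v)ˣ × ↥(normOneUnits (conjLocal L (IsCMField.complexConj L) v))) → ℂ, Integrable Θ μM ∧
            ∀ φ : Gqs L v → ℂ, IsLocSmooth φ ∧ tsupport φ ⊆ hyperbolicSet L v → σ.smoothTrace νQv φ = ∫ m, torusTransform L v mQv μM φ m * Θ m ∂μM) ∧
        -- (HM) the same for the H-side `Tr St_H(ξ_v)(f^H)`, `Θ_ρ ∈ L¹(M)` [p. 193]
        (∃ Θρ : ((UnitaryGroup.LocalRing L v)ˣ × ↥(normOneUnits (conjLocal L (IsCMField.complexConj L) v))) → ℂ, Integrable Θρ μM ∧ ∀ (φ : Gqs L v → ℂ) (fH : ((UnitaryGroup.cmDatum L 2 (Matrix.of fun i j : Fin 2 => if i.val + j.val + 1 = 2 then (1 : L) else 0)).Local v × (UnitaryGroup.cmDatum L 1 (Matrix.of fun i j : Fin 1 => if i.val + j.val + 1 = 1 then (1 : L) else 0)).Local v) → ℂ), IsLocSmooth φ ∧ tsupport φ ⊆ hyperbolicSet L v →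
            IsLocSmooth fH ∧ IsLocalDeltaTransfer L (qsForm L) v ((finExplicitCollection L (qsForm L) μ (finExplicitDelta_conj_left_all L (qsForm L) μ) (finExplicitDelta_conj_right_all L (qsForm L) μ)) v) mHv mQv fH φ → πSt.smoothTrace νHv fH = ∫ m, torusTransform L v mQv μM φ m * Θρ m ∂μM) ∧
        -- (SHF′) on EVERY non-unit shell `m₀ • M_c` (`m₀ ∉ M_c`), for CONTINUOUS pairs: the W-symmetrised `η`-isotypic shell function (`η = χ̃` or `(wχ)~`) is the torus transform of a
        --        hyperbolic test function [L. 12.7.1 proof p. 191 «there exists `f ∈ S` such that `F_f` has support in `η^m𝒪^* ∪ η^{−m}𝒪^*`», `m ≠ 0`; p. 193–194]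
        (∀ χ : (((UnitaryGroup.LocalRing L v)ˣ →* ℂˣ) × (↥(normOneUnits (conjLocal L (IsCMField.complexConj L) v)) →* ℂˣ)), Continuous χ.1 → Continuous χ.2 → ∀ (j : Bool) (m₀ : ((UnitaryGroup.LocalRing L v)ˣ × ↥(normOneUnits (conjLocal L (IsCMField.complexConj L) v)))), m₀ ∉ ((Submonoid.pi Set.univ (fun w : PlacesOver L v => (w.1.adicCompletionIntegers L).toSubring.toSubmonoid)).units.prod (⊤ : Subgroup ↥(normOneUnits (conjLocal L (IsCMField.complexConj L) v)))) → ∃ φ : Gqs L v → ℂ, (IsLocSmooth φ ∧ tsupport φ ⊆ hyperbolicSet L v) ∧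
            torusTransform L v mQv μM φ = fun m => ((m₀ • ((((Submonoid.pi Set.univ (fun w : PlacesOver L v => (w.1.adicCompletionIntegers L).toSubring.toSubmonoid)).units.prod (⊤ : Subgroup ↥(normOneUnits (conjLocal L (IsCMField.complexConj L) v)))) : Subgroup ((UnitaryGroup.LocalRing L v)ˣ × ↥(normOneUnits (conjLocal L (IsCMField.complexConj L) v)))) : Set ((UnitaryGroup.LocalRing L v)ˣ × ↥(normOneUnits (conjLocal L (IsCMField.complexConj L) v))))).indicator (fun m => (((pairChar L v (cond j (conjInvChar (conjLocal L (IsCMField.complexConj L) v) χ.1, χ.2) χ)) m₀ : ℂˣ) : ℂ) * ((((pairChar L v (cond j (conjInvChar (conjLocal L (IsCMField.complexConj L) v) χ.1, χ.2) χ)) m)⁻¹ : ℂˣ) : ℂ)) m) + ((m₀ • ((((Submonoid.pi Set.univ (fun w : PlacesOver L v => (w.1.adicCompletionIntegers L).toSubring.toSubmonoid)).units.prod (⊤ : Subgroup ↥(normOneUnits (conjLocal L (IsCMField.complexConj L) v)))) : Subgroup ((UnitaryGroup.LocalRing L v)ˣ × ↥(normOneUnits (conjLocal L (IsCMField.complexConj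 L) v)))) : Set ((UnitaryGroup.LocalRing L v)ˣ × ↥(normOneUnits (conjLocal L (IsCMField.complexConj L) v))))).indicator (fun m => (((pairChar L v (cond j (conjInvChar (conjLocal L (IsCMField.complexConj L) v) χ.1, χ.2) χ)) m₀ : ℂˣ) : ℂ) * ((((pairChar L v (cond j (conjInvChar (conjLocal L (IsCMField.complexConj L) v) χ.1, χ.2) χ)) m)⁻¹ : ℂˣ) : ℂ)) ((Units.map ((conjLocal L (IsCMField.complexConj L) v : UnitaryGroup.LocalRing L v →+* UnitaryGroup.LocalRing L v) : UnitaryGroup.LocalRing L v →* UnitaryGroup.LocalRing L v) m.1)⁻¹, m.2)))) →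
      ∀ aX : IrrClass (Gqs L v) → ℤ, (Function.support aX).Countable →
        (∀ π : IrrClass (Gqs L v), aX π ≠ 0 → π.IsUnitarizable) →
        (∀ (fH : ((UnitaryGroup.cmDatum L 2 (Matrix.of fun i j : Fin 2 => if i.val + j.val + 1 = 2 then (1 : L) else 0)).Local v × (UnitaryGroup.cmDatum L 1 (Matrix.of fun i j : Fin 1 => if i.val + j.val + 1 = 1 then (1 : L) else 0)).Local v) → ℂ) (φ : Gqs L v → ℂ), IsLocSmooth fH → IsLocSmooth φ →
            IsLocalDeltaTransfer L (qsForm L) v ((finExplicitCollection L (qsForm L) μ (finExplicitDelta_conj_left_all L (qsForm L) μ) (finExplicitDelta_conj_right_all L (qsForm L) μ)) v) mHv mQv fH φ →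
            Summable (fun π : IrrClass (Gqs L v) => (aX π : ℂ) * π.smoothTrace νQv φ) ∧
              ∑' π : IrrClass (Gqs L v), (aX π : ℂ) * π.smoothTrace νQv φ = πSt.smoothTrace νHv fH) →
        (Function.support aX).Finite ∧ ∀ π : IrrClass (Gqs L v), aX π ≠ 0 → π.IsSquareIntegrable μZ := by

  intro L _ _ _ μ ξ v hns hμu hμω _ _ _ _ νHv νQv _ _ _ _ mHv mQv hcanH hcanQ hTv π₁ πSt hHL hπ₁ _ _ μZ _
    𝔇 hμG hμH hμGZ horb hreg hTr hρ hW hUp hPCE hPCT h61a h61b h61c hLO hEONPS hEC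
    hHCH hUpReg hEll hDet hPiN hLds hL2domAll hUdom hsub hTell hTnon
    hLdsE hLdsU hLds2 hR0 hMU hStL2 hPi2L2
    par hPS1 hPS2 hPS3 hNP hUP
    hsplit hTOR
    aX hcnt hunit hid
  -- the organ's quotient σ-algebras and the Borel structure of `M`, re-installed as local instances
  letI : ∀ γ : Gqs L v, MeasurableSpace (Gqs L v ⧸ Subgroup.centralizer ({γ} : Set (Gqs L v))) := fun _ => borel _
  haveI : ∀ γ : Gqs L v, BorelSpace (Gqs L v ⧸ Subgroup.centralizer ({γ} : Set (Gqs L v))) := fun _ => ⟨rfl⟩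
  letI : MeasurableSpace ((UnitaryGroup.LocalRing L v)ˣ × ↥(normOneUnits (conjLocal L (IsCMField.complexConj L) v))) := borel _
  haveI : BorelSpace ((UnitaryGroup.LocalRing L v)ˣ × ↥(normOneUnits (conjLocal L (IsCMField.complexConj L) v))) := ⟨rfl⟩
  -- «VDW-SYMM★» (LH6-p02 (g2), ★ p849696): the W-invariance of van Dijk's weight, read through ★ `vanDijkWeight`
  have hVDW : ∀ (w₀ : ↥(unitaryGroupOfForm (conjLocal L (IsCMField.complexConj L) v) (cmLocalForm L 3 v))) (hw₀ : Units.val (w₀ : GL (Fin 3) (UnitaryGroup.LocalRing L v)) = cmLocalForm L 3 v) (t : ↥(cmBorelTriple L 3 v).M),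
      vanDijkWeight L v ⟨w₀ * (t : ↥(unitaryGroupOfForm (conjLocal L (IsCMField.complexConj L) v) (cmLocalForm L 3 v))) * w₀⁻¹, weylConj_mem_cmTorus L v w₀ hw₀ t⟩ = vanDijkWeight L v t :=
    fun w₀ hw₀ t => F0P3cStCharTSVanDijkWeylSymm.vanDijkWeight_weylConj L v w₀ hw₀ t ⟨w₀ * (t : ↥(unitaryGroupOfForm (conjLocal L (IsCMField.complexConj L) v) (cmLocalForm L 3 v))) * w₀⁻¹, weylConj_mem_cmTorus L v w₀ hw₀ t⟩ rfl
  refine F0P3cStCharTSSaHeadTorus.stSupportFiniteSqInt_of_carpet_torus L μ ξ v hns hμu hμω νHv νQv mHv mQv hcanH hcanQ hTv π₁ πSt hHL hπ₁ μZ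
    𝔇 hμG hμH hμGZ horb hreg hTr hρ hW hUp hPCE hPCT h61a h61b h61c hLO hEONPS hEC hHCH hUpReg hEll hDet hPiN hLds hL2domAll hUdom hsub hTell hTnon
    hLdsE hLdsU hLds2 hR0 hMU hStL2 hPi2L2 par hPS1 hPS2 hPS3 hNP hUP hsplit ?_ aX hcnt hunit hid
  -- ══ (TOR) of ★ p849458 from (TOR′): the witnesses are the NAMED TERMS, the pin is `rfl`, (PSM) is ★ «PSM★» ══
  intro μM _
  obtain ⟨hWM, hHM, hSHF⟩ := hTOR μM
  exact ⟨torusTransform L v mQv μM, hyperbolicSet L v, pairChar L v, fun χ m => pairChar_apply L v χ m, hWM, hHM,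
    psm_torusTransform L v hns νQv mQv hcanQ μM hVDW, hSHF⟩

end Summit.HodgeConjecture.HodgeConjecture.Cruxes.H413.F0P3cStCharTSSaHeadTorus2

end
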